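import Literature.RingTheory.MvPolynomial.MonomialIdealPowersVeronese
import Literature.Combinatorics.Optimization.CoverMonoidVeronese
import HarnessLib

/-!
# Herzog–Hibi–Trung 2007, Cor. 2.2 — PROOF of the named fact `HerzogHibiTrung2007_Cor2_2`

Topic: `Literature/RingTheory/MvPolynomial`; sibling proof file of `MonomialIdealPowersVeronese.lean`
(the fact `HerzogHibiTrung2007_Cor2_2`, typed there from J. Herzog, T. Hibi, N. V. Trung, *Symbolic powers of
monomial ideals and vertex cover algebras*, Adv. Math. 210 (2007) 304–322, Cor. 2.2: «Let `I_1, …, I_r ⊂ S` be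
monomial ideals. Then there exists an integer `d` such that `(⋂_{j=1}^r I_j^d)^k = ⋂_{j=1}^r I_j^{dk}` for all
`k ≥ 1`.»). Here the fact is DISCHARGED: `HerzogHibiTrung2007_Cor2_2_holds`.

Proof (the paper's, §§1–2, made elementary):
* §1 *Monomial calculus.* For a finite set `G` of exponents, `X^c ∈ (X^g : g ∈ G)^t` iff `c` dominates a
  count-sum `∑_{g ∈ G} u_g g` with `∑ u_g = t` (`monomial_mem_span_pow_of_counts`, `exists_counts_of_monomial_mem_span_pow`,
  via `(X^g : g ∈ G)^t ≤ (X^{∑ u_g g} : ∑ u_g = t)` and Mathlib's support criterion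
  `MvPolynomial.mem_ideal_span_monomial_image`); powers of monomial ideals are monomial
  (`monomial_mem_span_pow_of_mem_support`); every monomial ideal in finitely many variables is spanned by
  finitely many monomials (`IsMonomial.exists_finset_eq`, Dickson's lemma = Mathlib `Finsupp.wellQuasiOrderedLE`).
* §2 *The power monoid* `H(I) = {(c, t) ∈ ℕⁿ × ℕ | X^c ∈ I_j^t ∀ j}` (the monoid of the algebra
  `A = ⊕_k (⋂_j I_j^k) t^k` of Cor. 1.3) is the image of the equaliser of two additive maps out of a free monoid
  `ℕ^κ` (slack presentation: counts `u_{j,g}` with `∑_g u_{j,g} = t` and slacks `v_{j,i}` with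
  `∑_g u_{j,g} g_i + v_{j,i} = c_i`), hence FINITELY GENERATED by Mathlib's Gordan–Dickson lemma
  `AddSubmonoid.fg_eqLocusM` (`powerMonoid_fg`; this is Thm. 1.1 / Cor. 1.2 / Cor. 1.3 of the paper).
* §3 *Veronese.* A finitely generated graded submonoid of `ℕⁿ × ℕ` has a standard Veronese level `b₀ > 0`: every
  element of degree `k b₀` dominates a sum of `k` elements of degree `b₀` (`exists_level_of_fg`, Thm. 2.1 (a) ⇒ (b);
  the splitting engine is `Literature.Combinatorics.Optimization.CoverMonoid.exists_sum_of_degree_mul`).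
* §4 *Assembly.* `⋂_j I_j^{dk}` is spanned by its monomials `X^c`, `(c, dk) ∈ H(I)` splits, and
  `X^c = X^{c - ∑ a_i} ∏_i X^{a_i} ∈ (⋂_j I_j^d)^k`; the reverse containment is `iInf_pow_pow_le`.

Characteristic-free; in fact §§1–3 hold over any commutative semiring `R` (nontrivial where supports are read).
No new definitions of mathematical content: `powerMonoid`, `SlackIdx`, `lhsHom`, `rhsHom`, `projHom` are proof
plumbing (the slack presentation), kept public for reuse.
-/

namespace Literature.RingTheory.MvPolynomial

universe u v

open _root_.MvPolynomial

/-! ## §1 Monomial calculus -/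

section MonomialCalculus

variable {σ : Type u} {R : Type v} [CommSemiring R]

/-- **Counts ⇒ membership**: if `c ≥ ∑_{g ∈ G} u_g • g` with `∑_g u_g = t` then `X^c ∈ (X^g : g ∈ G)^t`
(`X^{∑ u_g g} = ∏_g (X^g)^{u_g} ∈ ∏_g I^{u_g} = I^t`). [cite: HerzogHibiTrung2007, §1 (monomial ideals and their powers; proof of Cor. 1.3)] -/
theorem monomial_mem_span_pow_of_counts (G : Finset (σ →₀ ℕ)) (u : G → ℕ) {t : ℕ} (ht : ∑ g, u g = t)
    {c : σ →₀ ℕ} (hc : ∑ g, u g • (g : σ →₀ ℕ) ≤ c) :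
    monomial c (1 : R) ∈ Ideal.span ((fun s => monomial s (1 : R)) '' (G : Set (σ →₀ ℕ))) ^ t := by
  subst ht
  have hsplit : monomial c (1 : R) =
      monomial (c - ∑ g, u g • (g : σ →₀ ℕ)) 1 * monomial (∑ g, u g • (g : σ →₀ ℕ)) 1 := by
    rw [monomial_mul, one_mul, tsub_add_cancel_of_le hc]
  rw [hsplit, monomial_sum_one, ← Finset.prod_pow_eq_pow_sum]
  refine Ideal.mul_mem_left _ _ (Ideal.prod_mem_prod fun g _ => ?_)
  have hpow : monomial (u g • (g : σ →₀ ℕ)) (1 : R) = monomial (g : σ →₀ ℕ) (1 : R) ^ u g := by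
    rw [monomial_pow, one_pow]
  rw [hpow]
  exact Ideal.pow_mem_pow (Ideal.subset_span (Set.mem_image_of_mem (fun s => monomial s (1 : R)) g.2)) _

/-- **Powers of a monomial ideal are bounded by count-sums**: `(X^g : g ∈ G)^t ≤ (X^{∑_g u_g g} : ∑_g u_g = t)`.
[cite: HerzogHibiTrung2007, §1 (monomial ideals and their powers; proof of Cor. 1.3)] -/
theorem span_monomial_pow_le_span_counts (G : Finset (σ →₀ ℕ)) (t : ℕ) :
    Ideal.span ((fun s => monomial s (1 : R)) '' (G : Set (σ →₀ ℕ))) ^ t ≤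
      Ideal.span ((fun s => monomial s (1 : R)) ''
        {s | ∃ u : G → ℕ, ∑ g, u g = t ∧ s = ∑ g, u g • (g : σ →₀ ℕ)}) := by
  classical
  induction t with
  | zero =>
    rw [pow_zero, Ideal.one_eq_top, top_le_iff, Ideal.eq_top_iff_one]
    refine Ideal.subset_span ⟨0, ⟨fun _ => 0, by simp, by simp⟩, ?_⟩
    change monomial (0 : σ →₀ ℕ) (1 : R) = 1
    rw [← C_apply, C_1]
  | succ t ih =>
    rw [pow_succ]
    refine (Ideal.mul_mono_left ih).trans ?_
    rw [Ideal.span_mul_span']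
    refine Ideal.span_mono ?_
    rintro _ ⟨_, ⟨s, ⟨u, hu, rfl⟩, rfl⟩, _, ⟨g₀, hg₀, rfl⟩, rfl⟩
    refine ⟨(∑ g, u g • (g : σ →₀ ℕ)) + g₀,
      ⟨fun g => u g + (if g = ⟨g₀, hg₀⟩ then 1 else 0), ?_, ?_⟩, ?_⟩
    · rw [Finset.sum_add_distrib, hu, Finset.sum_ite_eq' Finset.univ (⟨g₀, hg₀⟩ : G) (fun _ => 1)]
      simp
    · simp only [add_smul, Finset.sum_add_distrib, ite_smul, one_smul, zero_smul, Finset.sum_ite_eq',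
        Finset.mem_univ, if_true]
    · simp only [monomial_mul, one_mul]

/-- **Powers of monomial ideals are monomial**: if `f ∈ (X^g : g ∈ G)^t` then every monomial of `f` lies in
`(X^g : g ∈ G)^t`. [cite: HerzogHibiTrung2007, §1 (monomial ideals and their powers; proof of Cor. 1.3)] -/
theorem monomial_mem_span_pow_of_mem_support (G : Finset (σ →₀ ℕ)) {t : ℕ} {f : MvPolynomial σ R}
    (hf : f ∈ Ideal.span ((fun s => monomial s (1 : R)) '' (G : Set (σ →₀ ℕ))) ^ t) {c : σ →₀ ℕ}
    (hc : c ∈ f.support) :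
    monomial c (1 : R) ∈ Ideal.span ((fun s => monomial s (1 : R)) '' (G : Set (σ →₀ ℕ))) ^ t := by
  classical
  have h' := span_monomial_pow_le_span_counts (R := R) G t hf
  rw [mem_ideal_span_monomial_image] at h'
  obtain ⟨s, ⟨u, hu, rfl⟩, hsc⟩ := h' c hc
  exact monomial_mem_span_pow_of_counts G u hu hsc

/-- **Membership ⇒ counts**: if `X^c ∈ (X^g : g ∈ G)^t` then `c ≥ ∑_g u_g • g` for some counts with `∑_g u_g = t`
(`R` nontrivial, so that `X^c` has support `{c}`). [cite: HerzogHibiTrung2007, §1 (monomial ideals and their powers; proof of Cor. 1.3)] -/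
theorem exists_counts_of_monomial_mem_span_pow [Nontrivial R] (G : Finset (σ →₀ ℕ)) {t : ℕ} {c : σ →₀ ℕ}
    (h : monomial c (1 : R) ∈ Ideal.span ((fun s => monomial s (1 : R)) '' (G : Set (σ →₀ ℕ))) ^ t) :
    ∃ u : G → ℕ, ∑ g, u g = t ∧ ∑ g, u g • (g : σ →₀ ℕ) ≤ c := by
  classical
  have h' := span_monomial_pow_le_span_counts (R := R) G t h
  rw [mem_ideal_span_monomial_image] at h'
  obtain ⟨s, ⟨u, hu, rfl⟩, hsc⟩ := h' c (by
    rw [support_monomial, if_neg (one_ne_zero' R)]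
    exact Finset.mem_singleton_self c)
  exact ⟨u, hu, hsc⟩

/-- **Dickson**: a monomial ideal in finitely many variables is spanned by FINITELY many monomials (the minimal
exponents of any monomial generating set form a finite antichain). [cite: HerzogHibiTrung2007, §1 (monomial ideals of `S = K[x_1, …, x_n]`)] -/
theorem IsMonomial.exists_finset_eq [Finite σ] {I : Ideal (MvPolynomial σ R)} (hI : IsMonomial I) :
    ∃ G : Finset (σ →₀ ℕ), I = Ideal.span ((fun s => monomial s (1 : R)) '' (G : Set (σ →₀ ℕ))) := by
  obtain ⟨S, rfl⟩ := hI
  have hpwo : S.IsPWO := Set.isPWO_of_wellQuasiOrderedLE S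
  have hfin : {x | Minimal (· ∈ S) x}.Finite :=
    (setOf_minimal_antichain (· ∈ S)).finite_of_partiallyWellOrderedOn (hpwo.mono (setOf_minimal_subset S))
  refine ⟨hfin.toFinset, le_antisymm (Ideal.span_le.mpr ?_) (Ideal.span_mono (Set.image_mono fun z hz => ?_))⟩
  · rintro _ ⟨s, hs, rfl⟩
    obtain ⟨z, hzs, hz⟩ := hpwo.exists_le_minimal hs
    have hsplit : monomial s (1 : R) = monomial (s - z) 1 * monomial z 1 := by
      rw [monomial_mul, one_mul, tsub_add_cancel_of_le hzs]
    change monomial s (1 : R) ∈ Ideal.span _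
    rw [hsplit]
    exact Ideal.mul_mem_left _ _ (Ideal.subset_span ⟨z, by simpa using hz, rfl⟩)
  · have hz' : Minimal (· ∈ S) z := by simpa using hz
    exact hz'.prop

end MonomialCalculus

/-! ## §2 The power monoid of a family of ideals and its slack presentation (Gordan) -/

section PowerMonoid

variable {n r : ℕ} {R : Type v} [CommSemiring R]

/-- **The power monoid** `H(I) = {(c, t) ∈ ℕⁿ × ℕ | X^c ∈ I_j^t for all j}` of a family of ideals of
`R[X_1, …, X_n]`, graded by `t` (the monoid of monomials of `A = ⊕_t (⋂_j I_j^t)`). [cite: HerzogHibiTrung2007, Cor. 1.3 (the algebra `A`)] -/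
def powerMonoid (I : Fin r → Ideal (MvPolynomial (Fin n) R)) : AddSubmonoid ((Fin n → ℕ) × ℕ) where
  carrier := {h | ∀ j, monomial (Finsupp.equivFunOnFinite.symm h.1) (1 : R) ∈ I j ^ h.2}
  zero_mem' := fun j => by simp
  add_mem' := fun {a b} ha hb j => by
    have h1 : Finsupp.equivFunOnFinite.symm (a + b).1 =
        Finsupp.equivFunOnFinite.symm a.1 + Finsupp.equivFunOnFinite.symm b.1 := by
      ext i; simp
    have h2 : monomial (Finsupp.equivFunOnFinite.symm a.1 + Finsupp.equivFunOnFinite.symm b.1) (1 : R) =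
        monomial (Finsupp.equivFunOnFinite.symm a.1) 1 * monomial (Finsupp.equivFunOnFinite.symm b.1) 1 := by
      rw [monomial_mul, one_mul]
    change monomial (Finsupp.equivFunOnFinite.symm (a + b).1) (1 : R) ∈ I j ^ (a.2 + b.2)
    rw [h1, h2, pow_add]
    exact Ideal.mul_mem_mul (ha j) (hb j)

/-- Membership in the power monoid. [cite: HerzogHibiTrung2007, Cor. 1.3 (the algebra `A`)] -/
@[simp] theorem mem_powerMonoid {I : Fin r → Ideal (MvPolynomial (Fin n) R)} {h : (Fin n → ℕ) × ℕ} :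
    h ∈ powerMonoid I ↔ ∀ j, monomial (Finsupp.equivFunOnFinite.symm h.1) (1 : R) ∈ I j ^ h.2 :=
  Iff.rfl

variable (G : Fin r → Finset (Fin n →₀ ℕ))

/-- Slack presentation, index type: the exponent `c_i`, the degree `t`, one count `u_{j,g}` per generator `g ∈ G_j`,
one slack `v_{j,i}` per pair `(j, i)`. [cite: HerzogHibiTrung2007, Thm. 1.1 / Cor. 1.2 (proof: diagonal presentation)] -/
abbrev SlackIdx : Type := ((Fin n ⊕ Unit) ⊕ ((Σ j : Fin r, (G j)) ⊕ (Fin r × Fin n))) → ℕ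

/-- `w ↦ (j ↦ ∑_g u_{j,g} ; (j,i) ↦ ∑_g u_{j,g} g_i + v_{j,i})`. [cite: HerzogHibiTrung2007, Thm. 1.1 / Cor. 1.2 (proof)] -/
def lhsHom : SlackIdx G →+ ((Fin r ⊕ (Fin r × Fin n)) → ℕ) where
  toFun w := Sum.elim (fun j => ∑ g : G j, w (Sum.inr (Sum.inl ⟨j, g⟩)))
    (fun ji => (∑ g : G ji.1, w (Sum.inr (Sum.inl ⟨ji.1, g⟩)) * (g : Fin n →₀ ℕ) ji.2) + w (Sum.inr (Sum.inr ji)))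
  map_zero' := by
    ext x; rcases x with j | ⟨j, i⟩ <;> simp
  map_add' := fun a b => by
    ext x; rcases x with j | ⟨j, i⟩
    · simp [Finset.sum_add_distrib]
    · simp only [Sum.elim_inr, Pi.add_apply, add_mul, Finset.sum_add_distrib]
      ring

/-- `w ↦ (j ↦ t ; (j,i) ↦ c_i)`. [cite: HerzogHibiTrung2007, Thm. 1.1 / Cor. 1.2 (proof)] -/
def rhsHom : SlackIdx G →+ ((Fin r ⊕ (Fin r × Fin n)) → ℕ) where
  toFun w := Sum.elim (fun _ => w (Sum.inl (Sum.inr ()))) (fun ji => w (Sum.inl (Sum.inl ji.2)))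
  map_zero' := by
    ext x; rcases x with j | ⟨j, i⟩ <;> simp
  map_add' := fun a b => by
    ext x; rcases x with j | ⟨j, i⟩ <;> simp

/-- `w ↦ (c, t)`. [cite: HerzogHibiTrung2007, Thm. 1.1 / Cor. 1.2 (proof)] -/
def projHom : SlackIdx G →+ ((Fin n → ℕ) × ℕ) where
  toFun w := (fun i => w (Sum.inl (Sum.inl i)), w (Sum.inl (Sum.inr ())))
  map_zero' := rfl
  map_add' := fun _ _ => rfl

/-- **Slack presentation of the power monoid**: if `I_j = (X^g : g ∈ G_j)` then `H(I)` is the image under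
`w ↦ (c, t)` of the equaliser `{w | ∑_g u_{j,g} = t, ∑_g u_{j,g} g_i + v_{j,i} = c_i (∀ j, i)}`.
[cite: HerzogHibiTrung2007, Thm. 1.1 / Cor. 1.2 / Cor. 1.3 (proof)] -/
theorem powerMonoid_eq_map [Nontrivial R] (I : Fin r → Ideal (MvPolynomial (Fin n) R))
    (hG : ∀ j, I j = Ideal.span ((fun s => monomial s (1 : R)) '' (G j : Set (Fin n →₀ ℕ)))) :
    powerMonoid I = AddSubmonoid.map (projHom G) ((lhsHom G).eqLocusM (rhsHom G)) := by
  classical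
  ext ⟨c, t⟩
  simp only [mem_powerMonoid, AddSubmonoid.mem_map, AddMonoidHom.mem_eqLocusM]
  constructor
  · intro h
    have hex : ∀ j, ∃ u : G j → ℕ, ∑ g, u g = t ∧
        ∑ g, u g • (g : Fin n →₀ ℕ) ≤ Finsupp.equivFunOnFinite.symm c := fun j =>
      exists_counts_of_monomial_mem_span_pow (G j) (by rw [← hG j]; exact h j)
    choose u hu using hex
    refine ⟨Sum.elim (Sum.elim c (fun _ => t))
      (Sum.elim (fun jg => u jg.1 jg.2) (fun ji => c ji.2 - (∑ g, u ji.1 g • (g : Fin n →₀ ℕ)) ji.2)), ?_, rfl⟩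
    ext x
    rcases x with j | ⟨j, i⟩
    · simpa [lhsHom, rhsHom] using (hu j).1
    · have hle : (∑ g, u j g • (g : Fin n →₀ ℕ)) i ≤ c i := by
        have := (hu j).2 i
        simpa using this
      have hSi : (∑ g, u j g • (g : Fin n →₀ ℕ)) i = ∑ g, u j g * (g : Fin n →₀ ℕ) i := by
        simp [Finsupp.finsetSum_apply]
      simp only [lhsHom, rhsHom, AddMonoidHom.coe_mk, ZeroHom.coe_mk, Sum.elim_inr, Sum.elim_inl]
      rw [← hSi]
      omega
  · rintro ⟨w, hw, hproj⟩ j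
    have hc : c = fun i => w (Sum.inl (Sum.inl i)) := (congrArg Prod.fst hproj).symm
    have ht : t = w (Sum.inl (Sum.inr ())) := (congrArg Prod.snd hproj).symm
    subst hc ht
    rw [hG j]
    refine monomial_mem_span_pow_of_counts (G j) (fun g => w (Sum.inr (Sum.inl ⟨j, g⟩))) ?_ ?_
    · have := congrFun hw (Sum.inl j)
      simpa [lhsHom, rhsHom] using this
    · intro i
      have := congrFun hw (Sum.inr (j, i))
      simp only [lhsHom, rhsHom, AddMonoidHom.coe_mk, ZeroHom.coe_mk, Sum.elim_inr] at this
      have hSi : (∑ g, w (Sum.inr (Sum.inl ⟨j, g⟩)) • (g : Fin n →₀ ℕ)) i =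
          ∑ g, w (Sum.inr (Sum.inl ⟨j, g⟩)) * (g : Fin n →₀ ℕ) i := by
        simp [Finsupp.finsetSum_apply]
      simp only [Finsupp.coe_equivFunOnFinite_symm]
      rw [hSi]
      omega

/-- **Gordan (Herzog–Hibi–Trung 2007, Thm. 1.1 / Cor. 1.2 / Cor. 1.3)**: the power monoid of a family of monomial
ideals with finite monomial generating sets is FINITELY GENERATED (Mathlib's `AddSubmonoid.fg_eqLocusM` on the slack
presentation). [cite: HerzogHibiTrung2007, Cor. 1.3] -/
theorem powerMonoid_fg [Nontrivial R] (I : Fin r → Ideal (MvPolynomial (Fin n) R))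
    (hG : ∀ j, I j = Ideal.span ((fun s => monomial s (1 : R)) '' (G j : Set (Fin n →₀ ℕ)))) :
    (powerMonoid I).FG := by
  rw [powerMonoid_eq_map G I hG]
  exact (AddSubmonoid.fg_eqLocusM _ _).map _

end PowerMonoid

/-! ## §3 A finitely generated graded submonoid of `ℕⁿ × ℕ` has a standard Veronese level -/

/-- **Herzog–Hibi–Trung 2007, Thm. 2.1 (a) ⇒ (b), monoid form**: if `H ≤ ℕ^d × ℕ` (graded by the last coordinate)
is finitely generated, there is `b₀ > 0` such that for every `k ≥ 1` every `h ∈ H` of degree `k b₀` dominates (in the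
first component) a sum of `k` elements of `H` of degree `b₀`. With `m ≥ 1` positive-degree generators of degrees
dividing `L`, `b₀ = m L` (engine: `CoverMonoid.exists_sum_of_degree_mul`); with none, `b₀ = 1` (no element of positive
degree exists). [cite: HerzogHibiTrung2007, Thm. 2.1] -/
theorem exists_level_of_fg {d : ℕ} {H : AddSubmonoid ((Fin d → ℕ) × ℕ)} (hH : H.FG) :
    ∃ b₀ : ℕ, 0 < b₀ ∧ ∀ k : ℕ, 0 < k → ∀ h ∈ H, h.2 = k * b₀ →
      ∃ hs : Fin k → (Fin d → ℕ) × ℕ, (∀ j, hs j ∈ H ∧ (hs j).2 = b₀) ∧ (∑ j, hs j).1 ≤ h.1 := by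
  classical
  -- adapted from `Literature.Combinatorics.Optimization.CoverMonoid.exists_veronese_level` (res-L1-s36-pv-1)
  obtain ⟨G, hG⟩ := hH
  rcases Nat.eq_zero_or_pos (G.filter fun g => 0 < g.2).card with h0 | hm
  · refine ⟨1, Nat.one_pos, fun k hk h hh hdeg => ?_⟩
    exfalso
    rw [← hG, AddSubmonoid.mem_closure_finset] at hh
    obtain ⟨a, -, ha⟩ := hh
    have h2 : (∑ g ∈ G, a g • g).2 = 0 := by
      rw [Prod.snd_sum]
      refine Finset.sum_eq_zero fun g hg => ?_
      rw [Prod.smul_snd, smul_eq_mul]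
      have : g.2 = 0 := by
        by_contra hne
        have hmem : g ∈ G.filter (fun g => 0 < g.2) := Finset.mem_filter.mpr ⟨hg, Nat.pos_of_ne_zero hne⟩
        rw [Finset.card_eq_zero] at h0
        rw [h0] at hmem
        simp at hmem
      rw [this, mul_zero]
    rw [ha, hdeg] at h2
    omega
  · have hL0 : 0 < ∏ g ∈ G.filter (fun g => 0 < g.2), g.2 :=
      Finset.prod_pos fun g hg => (Finset.mem_filter.mp hg).2
    have hL : ∀ g ∈ G, 0 < g.2 → g.2 ∣ ∏ g ∈ G.filter (fun g => 0 < g.2), g.2 := fun g hg hpos =>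
      Finset.dvd_prod_of_mem _ (Finset.mem_filter.mpr ⟨hg, hpos⟩)
    exact ⟨(G.filter fun g => 0 < g.2).card * ∏ g ∈ G.filter (fun g => 0 < g.2), g.2, Nat.mul_pos hm hL0,
      fun k _ h hh hdeg =>
        Literature.Combinatorics.Optimization.CoverMonoid.exists_sum_of_degree_mul hG hL rfl hm k hh hdeg⟩

/-! ## §4 Assembly: the fact holds -/

/-- **Herzog–Hibi–Trung 2007, Corollary 2.2 — PROVED**: for monomial ideals `I_1, …, I_r` of `K[x_1, …, x_n]`
there is a positive integer `d` with `(⋂_j I_j^d)^k = ⋂_j I_j^{dk}` for all `k ≥ 1`. Discharges the named fact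
`HerzogHibiTrung2007_Cor2_2` of `MonomialIdealPowersVeronese.lean`. [cite: HerzogHibiTrung2007, Cor. 2.2] -/
theorem HerzogHibiTrung2007_Cor2_2_holds : HerzogHibiTrung2007_Cor2_2.{u} := by
  intro K _ n r I hI
  classical
  have hex : ∀ j, ∃ G : Finset (Fin n →₀ ℕ),
      I j = Ideal.span ((fun s => monomial s (1 : K)) '' (G : Set (Fin n →₀ ℕ))) := fun j =>
    (hI j).exists_finset_eq
  choose G hG using hex
  obtain ⟨b₀, hb₀, hver⟩ := exists_level_of_fg (powerMonoid_fg G I hG)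
  refine ⟨b₀, hb₀, fun k hk => le_antisymm (iInf_pow_pow_le I b₀ k) ?_⟩
  intro f hf
  rw [f.as_sum]
  refine Ideal.sum_mem _ fun c hc => ?_
  have hCm : monomial c (coeff c f) = C (coeff c f) * monomial c 1 := by
    rw [C_mul_monomial, mul_one]
  rw [hCm]
  refine Ideal.mul_mem_left _ _ ?_
  -- every monomial of `f` lies in `⋂_j I_j^{b₀ k}`
  have hmono : ∀ j, monomial c (1 : K) ∈ I j ^ (b₀ * k) := fun j => by
    have hfj : f ∈ I j ^ (b₀ * k) := (Ideal.mem_iInf.mp hf) j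
    rw [hG j] at hfj ⊢
    exact monomial_mem_span_pow_of_mem_support (G j) hfj hc
  have hH : ((c : Fin n → ℕ), k * b₀) ∈ powerMonoid I := fun j => by
    have : Finsupp.equivFunOnFinite.symm (c : Fin n → ℕ) = c := by ext i; simp
    rw [this, mul_comm]
    exact hmono j
  obtain ⟨hs, hhs, hle⟩ := hver k hk _ hH rfl
  -- the pieces
  have hpiece : ∀ i, monomial (Finsupp.equivFunOnFinite.symm (hs i).1) (1 : K) ∈ ⨅ j, I j ^ b₀ := fun i =>
    Ideal.mem_iInf.mpr fun j => by
      have h1 := (hhs i).1 j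
      rw [(hhs i).2] at h1
      exact h1
  have hsum_le : ∑ i, Finsupp.equivFunOnFinite.symm (hs i).1 ≤ c := fun x => by
    have hx := hle x
    simp only [Prod.fst_sum, Finset.sum_apply] at hx
    simpa [Finsupp.finsetSum_apply] using hx
  have hsplit : monomial c (1 : K) =
      monomial (c - ∑ i, Finsupp.equivFunOnFinite.symm (hs i).1) 1 *
        ∏ i, monomial (Finsupp.equivFunOnFinite.symm (hs i).1) 1 := by
    rw [← monomial_sum_one, monomial_mul, one_mul, tsub_add_cancel_of_le hsum_le]
  rw [hsplit]
  refine Ideal.mul_mem_left _ _ ?_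
  have hpow : (⨅ j, I j ^ b₀) ^ k = ∏ _i : Fin k, ⨅ j, I j ^ b₀ := by
    rw [Finset.prod_const, Finset.card_univ, Fintype.card_fin]
  rw [hpow]
  exact Ideal.prod_mem_prod fun i _ => hpiece i

end Literature.RingTheory.MvPolynomial
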